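import Literature.MathematicalPhysics.QuantumLattice.HubbardTPPWeightedClusterFloorInfVol
import HarnessLib

/-!
# The weighted infinite-volume Anderson cluster floor for object M — the `2 × 4` edition

Topic `MathematicalPhysics/QuantumLattice`, family `hubbard` (seat hubbard-box-p3). Companion of
`HubbardTPPWeightedClusterFloorInfVol` (`tiGroundEnergyDensityAt_tpp_ge_of_boxFloorsW_2x3`): the same two-orientation weighted cover
(Valentí–Stolze–Hirschfeld 1991 §II) with the open `2 × 4` box and its transpose. The translates of `[0,2)×[0,4)` and `[0,4)×[0,2)`
cover every site `2·8` times with total repulsion weight `2·Σ υ`, every nearest-neighbour bond with total weight `wsumV τ + wsumH τ`, every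
diagonal bond with `2·wsumD`, and every third-neighbour bond of `ℤ²` EXACTLY FOUR times (two rows × two column offsets, all in the orientation
whose long side is parallel to it — the four axial pairs of the `2 × 4` box are equivalent under its symmetries, so the uniform axial weight
`t''/4` loses nothing). Hence ONE kernel table `σ_k ≤ E₀(hubbardOpenBoxTT'T''W 2 4 τ υ ν (t''/4), k)` (`k ≤ 16`) with one supporting line gives
`2m − 16μρ ≤ e^M(t,t',t'',U; ρ)`. (Sector dimension up to `C(8,4)² = 4900`: a law for a future producer; the `2 × 3` edition is the one the
KLDL device serves today.) Everything is proved; no definition, no named fact.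

References: P. W. Anderson, Phys. Rev. 83 (1951) 1260, eq. (2) [cite: Anderson1951, eq. (2)]; R. Valentí, J. Stolze, P. J. Hirschfeld,
Phys. Rev. B 43 (1991) 13743, §II [cite: ValentiStolzeHirschfeld1991, §II]; D. Ruelle, *Statistical Mechanics: Rigorous Results* (1969), §3.4
[cite: Ruelle1969, §3.4]; E. Pavarini et al., PRL 87 (2001) 047003, eq. (1) [cite: PavariniEtAl2001, eq. (1)].
-/

noncomputable section

namespace Literature.MathematicalPhysics.QuantumLattice

open Matrix Finset HubbardWave0 Literature.Probability.LatticeModels ThermodynamicLimit ClusterLowerBound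
open scoped ComplexOrder

namespace InfVolFermionState

/-- Translate count inside the rectangle (kernel `decide`). [folklore] -/
private theorem card_rect42' : (halfOpenRect ![3, 1]).card = 8 := by decide
/-- Translate count inside the rectangle (kernel `decide`). [folklore] -/
private theorem cnt42_a0' : ((halfOpenRect ![3, 1]).filter (fun x => x + axial2Vec 0 ∈ halfOpenRect ![3, 1])).card = 4 := by decide
/-- Translate count inside the rectangle (kernel `decide`). [folklore] -/
private theorem cnt42_a1' : ((halfOpenRect ![3, 1]).filter (fun x => x + axial2Vec 1 ∈ halfOpenRect ![3, 1])).card = 0 := by decide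
/-- Translate count inside the rectangle (kernel `decide`). [folklore] -/
private theorem card_rect24' : (halfOpenRect ![1, 3]).card = 8 := by decide
/-- Translate count inside the rectangle (kernel `decide`). [folklore] -/
private theorem cnt24_a0' : ((halfOpenRect ![1, 3]).filter (fun x => x + axial2Vec 0 ∈ halfOpenRect ![1, 3])).card = 0 := by decide
/-- Translate count inside the rectangle (kernel `decide`). [folklore] -/
private theorem cnt24_a1' : ((halfOpenRect ![1, 3]).filter (fun x => x + axial2Vec 1 ∈ halfOpenRect ![1, 3])).card = 4 := by decide

/-- Sums over the `c × r` box re-indexed over the `r × c` box. [folklore] -/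
private theorem sum_rectSwap' {r c : ℕ} (g : Fin c ×ₗ Fin r → ℝ) :
    ∑ p : Fin c ×ₗ Fin r, g p = ∑ p : Fin r ×ₗ Fin c, g (rectSwap r c p) :=
  (Fintype.sum_equiv (rectSwap r c) _ _ fun _ => rfl).symm

/-- **THE WEIGHTED INFINITE-VOLUME ANDERSON CLUSTER FLOOR FOR OBJECT M, `2 × 4` EDITION (one table).** Symmetric bond weights `τ`,
repulsions `υ`, potentials `ν` on the open `2 × 4` box with `wsumV τ + wsumH τ = t`, `2·wsumD₁ τ = t'`, `2·wsumD₂ τ = t'`, `2·Σ υ = U`,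
`Σ ν = 0`; ONE kernel table `σ_k ≤ E₀(hubbardOpenBoxTT'T''W 2 4 τ υ ν (t''/4), k)` (`k ≤ 16`) and one supporting line `m ≤ σ_k + μk` give
`2m − 16μρ ≤ e^M(t,t',t'',U; ρ)` at every density `0 < ρ < 2`, EXACT in `t''`. [cite: Anderson1951, eq. (2)] [cite: ValentiStolzeHirschfeld1991, §II] [cite: Ruelle1969, §3.4] -/
theorem tiGroundEnergyDensityAt_tpp_ge_of_boxFloorsW_2x4 {σ : ℕ → ℝ} {τ : Fin 2 ×ₗ Fin 4 → Fin 2 ×ₗ Fin 4 → ℝ}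
    {υ ν : Fin 2 ×ₗ Fin 4 → ℝ} {t t' t'' U : ℝ} (hτ : ∀ x y, τ x y = τ y x) (ht : wsumV τ + wsumH τ = t)
    (hD₁ : 2 * wsumD₁ τ = t') (hD₂ : 2 * wsumD₂ τ = t') (hU : 2 * ∑ x, υ x = U) (hν : ∑ x, ν x = 0)
    (hF : ∀ k ≤ 16, σ k ≤ groundEnergy (hubbardOpenBoxTT'T''W 2 4 τ υ ν (t'' / 4)) k)
    (μ m : ℝ) (hm : ∀ k ≤ 16, m ≤ σ k + μ * k) {ρ : ℝ} (hρ0 : 0 < ρ) (hρ2 : ρ < 2) :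
    2 * m - 16 * μ * ρ ≤ (hubbardTT'T''FermionInteraction t t' t'' U).tiGroundEnergyDensityAt 2 ρ := by
  classical
  subst ht hD₁ hU
  refine (hubbardTT'T''FermionInteraction (wsumV τ + wsumH τ) (2 * wsumD₁ τ) t'' (2 * ∑ x, υ x)).le_tiGroundEnergyDensityAt 2
    (exists_isTranslationInvariant_density_eq hρ0 hρ2) fun ω hω hρ => ?_
  -- the transposed weights for the `4 × 2` orientation share the table
  have hτ's : ∀ x y : Fin 4 ×ₗ Fin 2, (fun p p' : Fin 4 ×ₗ Fin 2 => τ (rectSwap 4 2 p) (rectSwap 4 2 p')) x y =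
      (fun p p' : Fin 4 ×ₗ Fin 2 => τ (rectSwap 4 2 p) (rectSwap 4 2 p')) y x := fun x y => hτ _ _
  have hF' : ∀ k ≤ 16, σ k ≤ groundEnergy (hubbardOpenBoxTT'T''W 4 2 (fun p p' => τ (rectSwap 4 2 p) (rectSwap 4 2 p'))
      (fun p => υ (rectSwap 4 2 p)) (fun p => ν (rectSwap 4 2 p)) (t'' / 4)) k := fun k hk => by
    rw [groundEnergy_hubbardOpenBoxTT'T''W_swap]; exact hF k hk
  -- the two local floors
  obtain ⟨f, hf0, hf1⟩ : ∃ f : PolySite (halfOpenRect ![1, 3]) ≃ Fin 2 ×ₗ Fin 4,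
      (∀ a, (((ofLex (f a)).1 : ℕ) : ℤ) = ofLex a.1 0) ∧ (∀ a, (((ofLex (f a)).2 : ℕ) : ℤ) = ofLex a.1 1) :=
    exists_equiv_polySite_halfOpenRect_two ![1, 3]
  obtain ⟨g, hg0, hg1⟩ : ∃ g : PolySite (halfOpenRect ![3, 1]) ≃ Fin 4 ×ₗ Fin 2,
      (∀ a, (((ofLex (g a)).1 : ℕ) : ℤ) = ofLex a.1 0) ∧ (∀ a, (((ofLex (g a)).2 : ℕ) : ℤ) = ofLex a.1 1) :=
    exists_equiv_polySite_halfOpenRect_two ![3, 1]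
  have h1 := le_re_expect_relabel_tppW_of_sectorFloors ![1, 3] (r := 2) (c := 4) (by decide) (by decide) f hf0 hf1 ω τ hτ
    υ ν (t'' / 4) (σ := σ) (fun k hk => hF k (by omega)) μ m (fun k hk => hm k (by omega))
  have h2 := le_re_expect_relabel_tppW_of_sectorFloors ![3, 1] (r := 4) (c := 2) (by decide) (by decide) g hg0 hg1 ω _ hτ's
    (fun p => υ (rectSwap 4 2 p)) (fun p => ν (rectSwap 4 2 p)) (t'' / 4) (σ := σ)
    (fun k hk => hF' k (by omega)) μ m (fun k hk => hm k (by omega))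
  -- evaluate every term in the translation-invariant state `ω`
  rw [hω.re_expect_relabel_hubbardOpenBoxTT'W ![1, 3] f hf0 hf1 τ hτ υ ν, hω.expect_axial2_localHamiltonian (t'' / 4),
    hω.re_expect_totalNumber_eq_card_mul_density, card_rect24', hρ] at h1
  rw [hω.re_expect_relabel_hubbardOpenBoxTT'W ![3, 1] g hg0 hg1 _ hτ's, hω.expect_axial2_localHamiltonian (t'' / 4),
    hω.re_expect_totalNumber_eq_card_mul_density, card_rect42', hρ] at h2
  simp only [Fin.sum_univ_two, cnt24_a0', cnt24_a1', cnt42_a0', cnt42_a1'] at h1 h2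
  rw [wsumV_transpose, wsumH_transpose, wsumD₁_transpose, wsumD₂_transpose τ hτ, ← sum_rectSwap' υ, ← sum_rectSwap' ν] at h2
  -- the mean energy of `ω` through the same unit term densities
  have hid := hω.meanEnergy_tpp_two (wsumV τ + wsumH τ) (2 * wsumD₁ τ) t'' (2 * ∑ x, υ x)
  rw [Fin.sum_univ_two, Fin.sum_univ_two, Fin.sum_univ_two] at hid
  rw [ω.expect_axial2_pair_eq_mul (t'' / 4) 0, ω.expect_axial2_pair_eq_mul (t'' / 4) 1] at h1 h2
  -- name the unit term densities
  set D := ω.expect {0} ((hubbardFermionInteraction 2 0 1).Φ {0}) with hD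
  set K0 := ω.expect {0, 0 + unitVec 0} ((hubbardFermionInteraction 2 1 0).Φ {0, 0 + unitVec 0}) with hK0
  set K1 := ω.expect {0, 0 + unitVec 1} ((hubbardFermionInteraction 2 1 0).Φ {0, 0 + unitVec 1}) with hK1
  set P0 := ω.expect {0, 0 + diagVec 0} ((diagHoppingFermionInteraction 1).Φ {0, 0 + diagVec 0}) with hP0
  set P1 := ω.expect {0, 0 + diagVec 1} ((diagHoppingFermionInteraction 1).Φ {0, 0 + diagVec 1}) with hP1
  set A0 := ω.expect {0, 0 + axial2Vec 0} ((axialRange2HoppingFermionInteraction 2 1).Φ {0, 0 + axial2Vec 0}) with hA0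
  set A1 := ω.expect {0, 0 + axial2Vec 1} ((axialRange2HoppingFermionInteraction 2 1).Φ {0, 0 + axial2Vec 1}) with hA1
  simp only [Complex.add_re, Complex.mul_re, Complex.ofReal_re, Complex.ofReal_im, Complex.natCast_re, Complex.natCast_im,
    zero_mul, sub_zero] at h1 h2 hid
  have e1 : wsumD₂ τ * P1.re = wsumD₁ τ * P1.re := by rw [show wsumD₂ τ = wsumD₁ τ by linarith]
  have e2 : (∑ x, ν x) * ρ = 0 := by rw [hν, zero_mul]
  rw [hid]
  ring_nf at h1 h2 e1 e2 ⊢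
  linarith

end InfVolFermionState

end Literature.MathematicalPhysics.QuantumLattice

end
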